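import Summits.Parity.BatemanHorn.Theorems.SoloInformedSingularSeriesLimit
import Summits.Parity.BatemanHorn.Theorems.SoloInformedSchemaToConjE

/-!
# SoloInformedConjEIffLargeDivisors — Conjecture E ⟺ Möbius–log cancellation over the large divisors of `n² + 1`

Solo unit `solo-Parity-informed` (ideation tier, informed mode), session 8; `PLAN.md` §15.3/§16, CLAIMS C38.

The final form of the unit's deliverable, as ONE unconditional kernel equivalence.  For every `0 < ε < 1`,

  `hardyLittlewoodConjE_iff_largeDivisorSum_isLittleO`:
     HardyLittlewoodConjE   ⟺   T(x; ⌊x^{1-ε}⌋) = o(x),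
  where `T(x; D₀) = ∑_{1 ≤ n ≤ x} ∑_{d ∣ n²+1, d > D₀} μ(d) log d`
  (written over the cofactor `e = (n²+1)/d`:
   `∑_{n ≤ x} ∑_{e ∣ n²+1, (n²+1)/e > D₀} μ((n²+1)/e) log((n²+1)/e)`).

Ingredients: `ψ_{n²+1}(x) ~ 𝔖 x ⟺ T = o(x)` (`SoloInformedSingularSeriesLimit`, with `(R1)` now a theorem),
`ψ`-form ⟹ Conjecture E (`SoloInformedSchemaToConjE`), and — proved here by the reverse partial summation —
Conjecture E ⟹ `θ`-form ⟹ `ψ`-form: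
* `theta_upper_of_pi`, `theta_lower_of_pi` — scalar bookkeeping;
* `isEquivalent_theta_of_hardyLittlewoodConjE` — `π ~ (𝔖/2) x/log x ⟹ θ ~ 𝔖 x`
  (`θ ≤ π · log(x²+1)`, `θ ≥ (π - x^{1-c/4}) · 2(1 - c/4) log x`);
* `hardyLittlewoodConjE_iff_isEquivalent_sum_vonMangoldt` — `HardyLittlewoodConjE ⟺ ∑_{n ≤ x} Λ(n²+1) ~ 𝔖 x`;
* `hardyLittlewoodConjE_of_twoRanges` — the three-range schema `(R2)_ε → (R3)_ε → HardyLittlewoodConjE`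
  with its first range `(R1)` discharged.

No bearing on the truth of the conjecture: both sides of the headline equivalence are open.  What it records,
sorry-free, is WHERE the conjecture lives once everything classical is stripped: an `o(1)`-per-`n` cancellation
of `μ(d) log d` over divisor pairs `(n, d)`, `d ∣ n² + 1`, `d > x^{1-ε}` — divisor classes of length `< x^ε`,
beyond every distribution level available for the roots of `ν² + 1 ≡ 0 (mod d)` (`PLAN.md` §§8, 15).
-/

namespace Summit.Parity.BatemanHorn.Theorems

open Finset Filter ArithmeticFunction Asymptotics
open scoped ArithmeticFunction.Moebius Topology
open Literature.NumberTheory.Sieve (hardyLittlewoodEConst hardyLittlewoodEConst_pos HardyLittlewoodConjE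
  nSqAddOnePrimeCount hardyLittlewoodConjE_iff_isEquivalent)
open Literature.NumberTheory.Sieve.Iwaniec1978 (rho rem)

/-! ### Conjecture E ⟹ `θ ~ 𝔖 x`: scalar bookkeeping -/

/-- Upper bound: from `P ℓ ≤ (1 + c/4)(S/2) X`, `T ≤ P (2ℓ + 1)`, `0 ≤ P` and `4 ≤ c ℓ` conclude
`T - S X ≤ c · S X`. -/
theorem theta_upper_of_pi {S X ℓ c P T : ℝ} (hS : 0 < S) (hX0 : 0 < X) (hc : 0 < c) (hc1 : c ≤ 1)
    (hP0 : 0 ≤ P) (hPl : P * ℓ ≤ (1 + c / 4) * (S / 2) * X) (hT : T ≤ P * (2 * ℓ + 1))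
    (hcl : 4 ≤ c * ℓ) : T - S * X ≤ c * (S * X) := by
  have hSX : 0 < S * X := mul_pos hS hX0
  have h1 : P * ℓ ≤ S * X := hPl.trans (by nlinarith)
  have h2 : 4 * P ≤ c * (S * X) :=
    calc 4 * P ≤ c * ℓ * P := mul_le_mul_of_nonneg_right hcl hP0
      _ = c * (P * ℓ) := by ring
      _ ≤ c * (S * X) := mul_le_mul_of_nonneg_left h1 hc.le
  nlinarith

/-- Lower bound: from `(1 - c/4)(S/2) X ≤ P ℓ`, `(P - Y) · 2(1 - c/4)ℓ ≤ T` and `Y ℓ ≤ (c/8) S X`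
conclude `S X - T ≤ c · S X`. -/
theorem theta_lower_of_pi {S X ℓ c P T Y : ℝ} (hS : 0 < S) (hX0 : 0 < X) (hc : 0 < c) (hc1 : c ≤ 1)
    (hPl : (1 - c / 4) * (S / 2) * X ≤ P * ℓ) (hT : (P - Y) * (2 * (1 - c / 4) * ℓ) ≤ T)
    (hY : Y * ℓ ≤ c / 8 * (S * X)) : S * X - T ≤ c * (S * X) := by
  have hSX : 0 < S * X := mul_pos hS hX0
  have hk : 0 ≤ 2 * (1 - c / 4) := by linarith
  have h1 : 2 * (1 - c / 4) * ((1 - c / 4) * (S / 2) * X - c / 8 * (S * X)) ≤ T :=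
    calc 2 * (1 - c / 4) * ((1 - c / 4) * (S / 2) * X - c / 8 * (S * X))
        ≤ 2 * (1 - c / 4) * (P * ℓ - Y * ℓ) := mul_le_mul_of_nonneg_left (by linarith) hk
      _ = (P - Y) * (2 * (1 - c / 4) * ℓ) := by ring
      _ ≤ T := hT
  have h2 : 2 * (1 - c / 4) * ((1 - c / 4) * (S / 2) * X - c / 8 * (S * X))
      = S * X - 3 * c / 4 * (S * X) + c ^ 2 / 8 * (S * X) := by ring
  have h3 : 0 ≤ c * (S * X) := by positivity
  have h4 : 0 ≤ c ^ 2 / 8 * (S * X) := by positivity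
  linarith

/-- `log(x² + 1) ≤ 2 log x + 1` for `x ≥ 1`. -/
theorem log_sq_add_one_le {x : ℝ} (hx : 1 ≤ x) : Real.log (x ^ 2 + 1) ≤ 2 * Real.log x + 1 := by
  have h2 : x ^ 2 + 1 ≤ 2 * x ^ 2 := by nlinarith
  calc Real.log (x ^ 2 + 1) ≤ Real.log (2 * x ^ 2) := Real.log_le_log (by positivity) h2
    _ = Real.log 2 + 2 * Real.log x := by
        rw [Real.log_mul (by norm_num) (by positivity), Real.log_pow]; norm_num
    _ ≤ 2 * Real.log x + 1 := by linarith [Real.log_two_lt_d9]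

/-! ### Conjecture E ⟹ `θ ~ 𝔖 x` ⟹ `ψ ~ 𝔖 x` -/

/-- **Conjecture E ⟹ `θ`-form**: if `#{n ≤ x : n²+1 prime} ~ (𝔖/2) x/log x` then
`∑_{n ≤ x, n²+1 prime} log(n²+1) ~ 𝔖 x` (partial summation, cut at `x^{1-c/4}`). -/
theorem isEquivalent_theta_of_hardyLittlewoodConjE (h : HardyLittlewoodConjE) :
    (fun x : ℕ => ∑ n ∈ (Icc 1 x).filter (fun n : ℕ => Nat.Prime (n ^ 2 + 1)),
        Real.log ((n ^ 2 + 1 : ℕ) : ℝ)) ~[atTop]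
      fun x : ℕ => hardyLittlewoodEConst * (x : ℝ) := by
  have hπ := hardyLittlewoodConjE_iff_isEquivalent.mp h
  have hS := hardyLittlewoodEConst_pos
  have key : ∀ c : ℝ, 0 < c → c ≤ 1 → ∀ᶠ x : ℕ in atTop,
      |∑ n ∈ (Icc 1 x).filter (fun n : ℕ => Nat.Prime (n ^ 2 + 1)),
          Real.log ((n ^ 2 + 1 : ℕ) : ℝ) - hardyLittlewoodEConst * x|
        ≤ c * (hardyLittlewoodEConst * x) := by
    intro c hc hc1
    have e1 := hπ.isLittleO.bound (show (0 : ℝ) < c / 4 by positivity)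
    have e2 : ∀ᶠ t : ℝ in atTop,
        ‖Real.log t‖ ≤ c * hardyLittlewoodEConst / 8 * ‖t ^ (c / 4)‖ :=
      (isLittleO_log_rpow_atTop (by positivity : 0 < c / 4)).bound (by positivity)
    have hlogT : Tendsto (fun x : ℕ => Real.log (x : ℝ)) atTop atTop :=
      Real.tendsto_log_atTop.comp tendsto_natCast_atTop_atTop
    filter_upwards [e1, tendsto_natCast_atTop_atTop.eventually e2,
      hlogT.eventually_ge_atTop (4 / c), eventually_ge_atTop 3] with x hx1 hx2 hx3 hx4
    have hX : (3 : ℝ) ≤ x := by exact_mod_cast hx4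
    have hX0 : (0 : ℝ) < x := by linarith
    have hl0 : 0 < Real.log (x : ℝ) := Real.log_pos (by linarith)
    have hcl : 4 ≤ c * Real.log (x : ℝ) := by
      have := (div_le_iff₀ hc).mp hx3
      linarith
    have hm0 : 0 < hardyLittlewoodEConst / 2 * x / Real.log x := by positivity
    have hx1' : |(nSqAddOnePrimeCount x : ℝ) - hardyLittlewoodEConst / 2 * x / Real.log x|
        ≤ c / 4 * (hardyLittlewoodEConst / 2 * x / Real.log x) := by
      simpa only [Pi.sub_apply, Real.norm_eq_abs, abs_of_pos hm0] using hx1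
    obtain ⟨hP2, hP1⟩ := abs_sub_le_iff.mp hx1'
    have hml : hardyLittlewoodEConst / 2 * x / Real.log x * Real.log x
        = hardyLittlewoodEConst / 2 * x := div_mul_cancel₀ _ hl0.ne'
    have hPlU : (nSqAddOnePrimeCount x : ℝ) * Real.log x
        ≤ (1 + c / 4) * (hardyLittlewoodEConst / 2) * x := by
      have h' : (nSqAddOnePrimeCount x : ℝ)
          ≤ (1 + c / 4) * (hardyLittlewoodEConst / 2 * x / Real.log x) := by linarith
      calc (nSqAddOnePrimeCount x : ℝ) * Real.log x
          ≤ (1 + c / 4) * (hardyLittlewoodEConst / 2 * x / Real.log x) * Real.log x :=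
            mul_le_mul_of_nonneg_right h' hl0.le
        _ = (1 + c / 4) * (hardyLittlewoodEConst / 2) * x := by rw [mul_assoc, hml]; ring
    have hPlL : (1 - c / 4) * (hardyLittlewoodEConst / 2) * x
        ≤ (nSqAddOnePrimeCount x : ℝ) * Real.log x := by
      have h' : (1 - c / 4) * (hardyLittlewoodEConst / 2 * x / Real.log x)
          ≤ (nSqAddOnePrimeCount x : ℝ) := by linarith
      calc (1 - c / 4) * (hardyLittlewoodEConst / 2) * x
          = (1 - c / 4) * (hardyLittlewoodEConst / 2 * x / Real.log x) * Real.log x := by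
            rw [mul_assoc (1 - c / 4) (hardyLittlewoodEConst / 2 * x / Real.log x), hml]; ring
        _ ≤ (nSqAddOnePrimeCount x : ℝ) * Real.log x := mul_le_mul_of_nonneg_right h' hl0.le
    rw [abs_sub_le_iff]
    constructor
    · -- upper bound: `θ ≤ π · log(x²+1) ≤ π · (2 log x + 1)`
      have hT : ∑ n ∈ (Icc 1 x).filter (fun n : ℕ => Nat.Prime (n ^ 2 + 1)),
            Real.log ((n ^ 2 + 1 : ℕ) : ℝ)
          ≤ (nSqAddOnePrimeCount x : ℝ) * (2 * Real.log x + 1) :=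
        (theta_le_card_mul_log x).trans
          (mul_le_mul_of_nonneg_left (log_sq_add_one_le (by linarith)) (Nat.cast_nonneg _))
      exact theta_upper_of_pi hS hX0 hc hc1 (Nat.cast_nonneg _) hPlU hT hcl
    · -- lower bound: cut at `Y = ⌊x^{1-c/4}⌋`
      have hy1 : (⌊(x : ℝ) ^ (1 - c / 4)⌋₊ : ℝ) ≤ (x : ℝ) ^ (1 - c / 4) :=
        Nat.floor_le (by positivity)
      have hy2 : (x : ℝ) ^ (1 - c / 4) ≤ (⌊(x : ℝ) ^ (1 - c / 4)⌋₊ : ℝ) + 1 :=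
        (Nat.lt_floor_add_one _).le
      have hL0 : 0 ≤ 2 * (1 - c / 4) * Real.log x := by nlinarith
      have hL : 2 * (1 - c / 4) * Real.log x
          ≤ 2 * Real.log ((⌊(x : ℝ) ^ (1 - c / 4)⌋₊ : ℝ) + 1) := by
        rw [mul_assoc, ← Real.log_rpow hX0]
        have := Real.log_le_log (by positivity) hy2
        linarith
      have hT := card_sub_mul_le_theta x ⌊(x : ℝ) ^ (1 - c / 4)⌋₊ hL0 hL
      rw [Real.norm_eq_abs, Real.norm_eq_abs, abs_of_pos hl0,
        abs_of_pos (by positivity)] at hx2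
      have hY : (⌊(x : ℝ) ^ (1 - c / 4)⌋₊ : ℝ) * Real.log x
          ≤ c / 8 * (hardyLittlewoodEConst * x) := by
        have h' := mul_le_mul hy1 hx2 hl0.le (by positivity : (0 : ℝ) ≤ (x : ℝ) ^ (1 - c / 4))
        rw [mul_left_comm, ← Real.rpow_add hX0, show 1 - c / 4 + c / 4 = (1 : ℝ) by ring,
          Real.rpow_one] at h'
        linarith
      exact theta_lower_of_pi hS hX0 hc hc1 hPlL hT hY
  show (fun x : ℕ => ∑ n ∈ (Icc 1 x).filter (fun n : ℕ => Nat.Prime (n ^ 2 + 1)),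
      Real.log ((n ^ 2 + 1 : ℕ) : ℝ) - hardyLittlewoodEConst * x)
    =o[atTop] fun x : ℕ => hardyLittlewoodEConst * x
  rw [isLittleO_iff]
  intro c hc
  filter_upwards [key (min c 1) (lt_min hc one_pos) (min_le_right _ _),
    eventually_ge_atTop 1] with x hx hx1
  have hX : (1 : ℝ) ≤ x := by exact_mod_cast hx1
  have hm0 : 0 < hardyLittlewoodEConst * x := by positivity
  rw [Real.norm_eq_abs, Real.norm_eq_abs, abs_of_pos hm0]
  exact hx.trans (mul_le_mul_of_nonneg_right (min_le_left _ _) hm0.le)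

/-- **Conjecture E ⟹ `ψ`-form**: `∑_{n ≤ x} Λ(n²+1) ~ 𝔖 x` (the proper prime powers are `o(x)`,
`SoloInformedProperPrimePowers`). -/
theorem isEquivalent_sum_vonMangoldt_of_hardyLittlewoodConjE (h : HardyLittlewoodConjE) :
    (fun x : ℕ => ∑ n ∈ Icc 1 x, Λ (n ^ 2 + 1)) ~[atTop]
      fun x : ℕ => hardyLittlewoodEConst * (x : ℝ) := by
  have hS := hardyLittlewoodEConst_pos
  have hE : (fun x : ℕ => ∑ n ∈ (Icc 1 x).filter
      (fun n : ℕ => ¬Nat.Prime (n ^ 2 + 1) ∧ IsPrimePow (n ^ 2 + 1)), Λ (n ^ 2 + 1)) =o[atTop]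
        fun x : ℕ => hardyLittlewoodEConst * (x : ℝ) := by
    rw [isLittleO_iff]
    intro c hc
    filter_upwards [eventually_properPrimePow_sum_le (mul_pos hc hS)] with x hx
    rw [Real.norm_eq_abs, Real.norm_eq_abs,
      abs_of_nonneg (properPrimePow_sum_nonneg x), abs_of_nonneg (by positivity)]
    linarith
  have heq : (fun x : ℕ => ∑ n ∈ Icc 1 x, Λ (n ^ 2 + 1))
      = (fun x : ℕ => ∑ n ∈ (Icc 1 x).filter (fun n : ℕ => Nat.Prime (n ^ 2 + 1)),
          Real.log ((n ^ 2 + 1 : ℕ) : ℝ))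
        + fun x : ℕ => ∑ n ∈ (Icc 1 x).filter
          (fun n : ℕ => ¬Nat.Prime (n ^ 2 + 1) ∧ IsPrimePow (n ^ 2 + 1)), Λ (n ^ 2 + 1) := by
    funext x
    simp only [Pi.add_apply]
    exact sum_vonMangoldt_eq_theta_add x
  rw [heq]
  exact (isEquivalent_theta_of_hardyLittlewoodConjE h).add_isLittleO hE

/-- **`HardyLittlewoodConjE ⟺ ∑_{n ≤ x} Λ(n²+1) ~ 𝔖 x`.** -/
theorem hardyLittlewoodConjE_iff_isEquivalent_sum_vonMangoldt :
    HardyLittlewoodConjE ↔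
      (fun x : ℕ => ∑ n ∈ Icc 1 x, Λ (n ^ 2 + 1)) ~[atTop]
        fun x : ℕ => hardyLittlewoodEConst * (x : ℝ) :=
  ⟨isEquivalent_sum_vonMangoldt_of_hardyLittlewoodConjE,
    hardyLittlewoodConjE_of_isEquivalent_sum_vonMangoldt⟩

/-! ### The headline equivalence and the two-range schema -/

/-- **Hardy–Littlewood's Conjecture E ⟺ large-divisor Möbius–log cancellation** (any one `0 < ε < 1`):
`#{n ≤ x : n² + 1 prime} ~ (𝔖/2) x/log x` holds if and only if
`∑_{n ≤ x} ∑_{d ∣ n²+1, d > ⌊x^{1-ε}⌋} μ(d) log d = o(x)` (the inner sum written over the cofactor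
`e = (n²+1)/d`). -/
theorem hardyLittlewoodConjE_iff_largeDivisorSum_isLittleO {ε : ℝ} (hε : 0 < ε) (hε1 : ε < 1) :
    HardyLittlewoodConjE ↔
      (fun x : ℕ => ∑ n ∈ Icc 1 x,
          ∑ e ∈ (n ^ 2 + 1).divisors with ⌊(x : ℝ) ^ (1 - ε)⌋₊ < (n ^ 2 + 1) / e,
            (μ ((n ^ 2 + 1) / e) : ℝ) * Real.log (((n ^ 2 + 1) / e : ℕ) : ℝ))
        =o[atTop] fun x : ℕ => (x : ℝ) :=
  hardyLittlewoodConjE_iff_isEquivalent_sum_vonMangoldt.trans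
    (isEquivalent_sum_vonMangoldt_iff_largeDivisorSum_isLittleO' hε hε1)

/-- **The three-range schema with its first range discharged**: `(R2)_ε → (R3)_ε → HardyLittlewoodConjE`
(hypotheses exactly as in `hardyLittlewoodConjE_of_threeRanges`, minus `(R1)`, which is the theorem
`tendsto_neg_sum_moebius_log_rho_div`). -/
theorem hardyLittlewoodConjE_of_twoRanges {ε : ℝ} (hε : 0 < ε)
    (R2 : ∀ δ : ℝ, 0 < δ → ∀ᶠ x : ℕ in atTop,
      |∑ d ∈ (Icc 1 ⌊(x : ℝ) ^ (1 + ε)⌋₊).filter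
          (fun d : ℕ => (x : ℝ) ^ (1 - ε) < d), (μ d : ℝ) * Real.log d * rem (x : ℝ) d|
        ≤ δ * x)
    (R3 : ∀ δ : ℝ, 0 < δ → ∀ᶠ x : ℕ in atTop,
      ∑ e ∈ Icc 1 (⌊2 * (x : ℝ) ^ (1 - ε)⌋₊ + 1),
          (range (x + 1)).sup' nonempty_range_add_one (fun y =>
            |∑ n ∈ (Icc 1 y).filter (fun n => e ∣ n ^ 2 + 1), (μ ((n ^ 2 + 1) / e) : ℝ)|)
        ≤ δ * x / Real.log x) :
    HardyLittlewoodConjE :=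
  hardyLittlewoodConjE_of_threeRanges hε tendsto_neg_sum_moebius_log_rho_div R2 R3

end Summit.Parity.BatemanHorn.Theorems
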